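import Mathlib
import Summits.Ventures.DiscreteObjects.Mahler.SubLehmerDegree58

/-!
# Integer quadratics of Mahler measure one (venture `DiscreteObjects`, target L)

Cell `pub-namedobj`, seat `pub-namedobj-mahler` (gen 5). Framing: lottery ticket; floor = certified
bounds/negative ranges.

Completes `quadratic_of_measure_one` (`SubLehmerDegree58.lean`): a MONIC integer quadratic of Mahler
measure `1` is one of the nine polynomials `x², x² ± x, (x ± 1)², x² − 1, x² + 1, x² ± x + 1`
(Kronecker for degree 2, by hand): the coefficient bounds leave `15` candidates and the six others
(`x² ± 2x`, `x² ± x − 1`, `x² ± 2x − 1`) have a real root of modulus `> 1`, hence measure `> 1`.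
These nine are exactly the possible quadratic cofactors `C` in `subLehmer_degree58_structure`, i.e. the
explicit list of "offset" families of the degree-58 census over the degree-56 slice (EFFICIENCY-L6c §10).
-/

namespace Summit.Ventures.DiscreteObjects.Mahler

open Polynomial Literature.NumberTheory.MahlerMeasure

/-- A monic integer polynomial with a real root of modulus `> 1` has Mahler measure `> 1`. -/
theorem one_lt_intMahlerMeasure_of_real_root {b : ℤ[X]} (hb : b.Monic) {r : ℝ}
    (hr : aeval (r : ℂ) b = 0) (h1 : 1 < |r|) : 1 < intMahlerMeasure b := by
  have hle := norm_root_le_intMahlerMeasure hb hr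
  rw [Complex.norm_real, Real.norm_eq_abs] at hle
  linarith

/-- A monic integer quadratic written out from its coefficients. -/
theorem quadratic_eq_of_coeff {b : ℤ[X]} (hdeg : b.natDegree = 2) (hmonic : b.coeff 2 = 1) :
    b = X ^ 2 + C (b.coeff 1) * X + C (b.coeff 0) := by
  have h := b.as_sum_range_C_mul_X_pow
  rw [hdeg] at h
  conv_lhs => rw [h]
  simp only [Finset.sum_range_succ, Finset.sum_range_zero, zero_add, pow_zero, mul_one, pow_one,
    hmonic, map_one, one_mul]
  ring

/-- Evaluation of a monic integer quadratic at a real number (through `ℂ`). -/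
theorem aeval_quadratic_real {b : ℤ[X]} (hdeg : b.natDegree = 2) (hmonic : b.coeff 2 = 1) (r : ℝ) :
    aeval (r : ℂ) b = ((r ^ 2 + (b.coeff 1 : ℝ) * r + (b.coeff 0 : ℝ) : ℝ) : ℂ) := by
  conv_lhs => rw [quadratic_eq_of_coeff hdeg hmonic]
  simp only [map_add, map_mul, map_pow, aeval_X, eq_intCast, map_intCast]
  push_cast
  ring

/-- If the real quadratic `x² + c₁ x + c₀` changes sign on `[lo, hi]` with `1 < lo` or `hi < -1`, the
monic integer quadratic with these coefficients has Mahler measure `> 1` (it has a real root of modulus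
`> 1`). -/
theorem one_lt_measure_of_sign_change {b : ℤ[X]} (hdeg : b.natDegree = 2) (hmonic : b.coeff 2 = 1)
    {lo hi : ℝ} (hlohi : lo ≤ hi) (hfar : 1 < lo ∨ hi < -1)
    (hsign : (lo ^ 2 + (b.coeff 1 : ℝ) * lo + (b.coeff 0 : ℝ) ≤ 0 ∧ 0 ≤ hi ^ 2 + (b.coeff 1 : ℝ) * hi + (b.coeff 0 : ℝ)) ∨
             (0 ≤ lo ^ 2 + (b.coeff 1 : ℝ) * lo + (b.coeff 0 : ℝ) ∧ hi ^ 2 + (b.coeff 1 : ℝ) * hi + (b.coeff 0 : ℝ) ≤ 0)) :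
    1 < intMahlerMeasure b := by
  set f : ℝ → ℝ := fun x => x ^ 2 + (b.coeff 1 : ℝ) * x + (b.coeff 0 : ℝ) with hf
  have hcont : Continuous f := by rw [hf]; fun_prop
  obtain ⟨r, hrI, hrf⟩ : ∃ r ∈ Set.Icc lo hi, f r = 0 := by
    rcases hsign with ⟨hlo, hhi⟩ | ⟨hlo, hhi⟩
    · exact intermediate_value_Icc hlohi hcont.continuousOn ⟨hlo, hhi⟩
    · exact intermediate_value_Icc' hlohi hcont.continuousOn ⟨hhi, hlo⟩
  have hmon : b.Monic := by
    rw [Monic, leadingCoeff, hdeg, hmonic]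
  have hroot : aeval (r : ℂ) b = 0 := by
    rw [aeval_quadratic_real hdeg hmonic]
    have : f r = 0 := hrf
    rw [hf] at this
    simp only at this
    rw [this]; simp
  refine one_lt_intMahlerMeasure_of_real_root hmon hroot ?_
  rcases hfar with h | h
  · have : 1 < r := lt_of_lt_of_le h hrI.1
    rw [abs_of_pos (by linarith)]; exact this
  · have : r < -1 := lt_of_le_of_lt hrI.2 h
    rw [abs_of_neg (by linarith)]; linarith

/-- **Monic integer quadratics of Mahler measure one** are exactly `x², x² ± x, (x ± 1)², x² − 1,
x² + 1, x² ± x + 1`: in terms of `(c₀, c₁)`: `c₀ = 0, |c₁| ≤ 1` or `c₀ = 1, |c₁| ≤ 2` or `(c₀, c₁) = (−1, 0)`. -/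
theorem measure_one_monic_quadratic {b : ℤ[X]} (hdeg : b.natDegree = 2) (hmonic : b.coeff 2 = 1)
    (hM : intMahlerMeasure b = 1) :
    (b.coeff 0 = 0 ∧ -1 ≤ b.coeff 1 ∧ b.coeff 1 ≤ 1) ∨ (b.coeff 0 = 1 ∧ -2 ≤ b.coeff 1 ∧ b.coeff 1 ≤ 2) ∨
      (b.coeff 0 = -1 ∧ b.coeff 1 = 0) := by
  obtain ⟨_, h1, h0⟩ := quadratic_of_measure_one hdeg hM
  have h0' := abs_le.mp h0
  have h1' := abs_le.mp h1
  -- the six excluded pairs have a real root of modulus > 1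
  have excl : ¬ ((b.coeff 0 = 0 ∧ (b.coeff 1 = 2 ∨ b.coeff 1 = -2)) ∨
      (b.coeff 0 = -1 ∧ (b.coeff 1 = 1 ∨ b.coeff 1 = -1 ∨ b.coeff 1 = 2 ∨ b.coeff 1 = -2))) := by
    intro hbad
    have hgt : 1 < intMahlerMeasure b := by
      rcases hbad with ⟨hc0, hc1 | hc1⟩ | ⟨hc0, hc1 | hc1 | hc1 | hc1⟩
      · -- x² + 2x: root -2
        exact one_lt_measure_of_sign_change hdeg hmonic (lo := -2) (hi := -2) le_rfl (Or.inr (by norm_num))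
          (Or.inl ⟨by rw [hc0, hc1]; norm_num, by rw [hc0, hc1]; norm_num⟩)
      · -- x² - 2x: root 2
        exact one_lt_measure_of_sign_change hdeg hmonic (lo := 2) (hi := 2) le_rfl (Or.inl (by norm_num))
          (Or.inl ⟨by rw [hc0, hc1]; norm_num, by rw [hc0, hc1]; norm_num⟩)
      · -- x² + x - 1: root in [-1.7, -1.6] (f decreasing there)
        exact one_lt_measure_of_sign_change hdeg hmonic (lo := -17/10) (hi := -8/5) (by norm_num) (Or.inr (by norm_num))
          (Or.inr ⟨by rw [hc0, hc1]; norm_num, by rw [hc0, hc1]; norm_num⟩)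
      · -- x² - x - 1: root in [1.6, 1.7]
        exact one_lt_measure_of_sign_change hdeg hmonic (lo := 8/5) (hi := 17/10) (by norm_num) (Or.inl (by norm_num))
          (Or.inl ⟨by rw [hc0, hc1]; norm_num, by rw [hc0, hc1]; norm_num⟩)
      · -- x² + 2x - 1: root in [-2.5, -2.4] (f decreasing there)
        exact one_lt_measure_of_sign_change hdeg hmonic (lo := -5/2) (hi := -12/5) (by norm_num) (Or.inr (by norm_num))
          (Or.inr ⟨by rw [hc0, hc1]; norm_num, by rw [hc0, hc1]; norm_num⟩)
      · -- x² - 2x - 1: root in [2.4, 2.5]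
        exact one_lt_measure_of_sign_change hdeg hmonic (lo := 12/5) (hi := 5/2) (by norm_num) (Or.inl (by norm_num))
          (Or.inl ⟨by rw [hc0, hc1]; norm_num, by rw [hc0, hc1]; norm_num⟩)
    linarith
  omega

end Summit.Ventures.DiscreteObjects.Mahler
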